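import Mathlib
import HarnessLib
import Literature.Computability.AlgebraicComplexity.TensorSemiringSpectrum
import Literature.Computability.AlgebraicComplexity.AsymptoticRankMatMul
import Literature.Computability.AlgebraicComplexity.FlatteningBound
import Literature.Computability.AlgebraicComplexity.BigCwFourthOmega
import Summits.MatrixMultiplication.MatrixMultiplication.Theorems.OutsiderSandwichBlockSubrank
import Summits.MatrixMultiplication.MatrixMultiplication.Theorems.OutsiderSandwichExchangeRate

/-!
# Outsider sandwich — the EXCHANGE EXPONENT `θ⋆` of the one-block leaf (decomp-mm lens-4, g20; part 2)

Continues `OutsiderSandwichExchangeRate` (`Helped N B :⟺ ⟨B⟩ ⊠ C₁^{⊠N} ⊵ ⟨2,2,2⟩^{⊠N}`,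
`ExponentAchieved θ :⟺ cofinally some B ≤ 2^{θN} is Helped`; `BlockOneIsMM ⟺ ∀ θ > 0, ExponentAchieved θ`).
All hypothesis-free:
* §3b THE LASER FLOOR: **every rate `θ > ω(ℂ) − 2` is achieved** (`exponentAchieved_of_gt_omega_sub_two`):
  lens-4's `BlockDiagonal` (`Q̃(C₁) = 4`: cofinally `⟨r⟩ ≤ C₁^{⊠N}`, `r ≥ 4^N 2^{−δN}`) against
  `R(⟨2,2,2⟩^{⊠N}) ≤ R(⟨2^N,2^N,2^N⟩) ≤ C 2^{(ω+δ)N}` gives `⌊R/r⌋ + 1 ≤ 2^{(ω−2+3δ)N}` helping copies;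
  numerically every `θ > 0.37295` by the tree's KERNEL bound `LeGall2014_cw4_omega_le`.
* §4 THE EXTREMAL FORM: `θ⋆ := exchangeExponent = inf {θ | ExponentAchieved θ}` satisfies
  `0 ≤ θ⋆ ≤ min (1, ω − 2) ≤ 0.37295`, everything above `θ⋆` is achieved and nothing below;
  **`BlockOneIsMM ⟺ θ⋆ = 0`**, **`¬ BlockOneIsMM ⟺ θ⋆ > 0`** (the minimal counterexample IS the number `θ⋆`),
  **`ω = 2 ⟺ θ⋆ = 0 ∧ CouplingMergeOptimal`** (`summit_iff_exchangeExponent`).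
* §5 THE EXCHANGE NUMBERS `r(N) := min {B | Helped N B}`: `r(0) = 1`, **`r(1) = 2`**, `2 ≤ r(N) ≤ 2^N`,
  SUBMULTIPLICATIVE `r(M+N) ≤ r(M) r(N)`; `BlockOneIsMM ⟺ ∀ θ > 0, ∃ N ≥ 1, r(N) ≤ 2^{θN}` (= `inf_N log₂ r(N)/N = 0`;
  the census instrument's `r(2) = 2`, `r(3) ≤ 3`, `r(n) ≤ ⌈(4/3)^n⌉`, `n ≤ 6`, are upper rungs of this sequence).
* §6 COFINAL = EVENTUAL (padding `N' = kN + j`): an achieved rate `θ` yields every `θ' > θ` at ALL large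
  levels, so the stub's cofinal form equals the eventual form (`blockOneIsMM_iff_eventually`) and
  `θ⋆ = lim_N log₂ r(N) / N` is a limit, not a lim inf.
The ladder in one currency: `1 (N=1) → 1/2 (N=2, lens-2) → log₂(4/3) ≈ 0.415 (symmetric covers, census I59,
conjectural) → 0.37295 (laser floor, PROVED, ineffective N) → θ⋆ → 0 = leaf (attained at no finite N)`.

[Strassen1988, Thm. 3.8]; [Strassen1991, Thm. 6.1]; [Zuiddam2018, §2.3, §2.8]; [Blaser2013, Thm. 6.3];
[LeGall2014, Table 2]; [AlmanDuanVassilevskaWilliamsXuXuZhou2025, §3.4].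
-/

noncomputable section

open Filter Topology
open Literature.Computability.AlgebraicComplexity
open Summit.MatrixMultiplication.MatrixMultiplication.Theorems.OutsiderSandwichCoupling (coupling₁)
open Summit.MatrixMultiplication.MatrixMultiplication.Theorems.OutsiderSandwichExchangeRate

namespace Summit.MatrixMultiplication.MatrixMultiplication.Theorems.OutsiderSandwichExchangeExponent

/-! ## 3b. The laser floor -/


/-- From a diagonal `⟨r⟩ ≤ C₁^{⊠N}` (`r ≥ 1`): `Helped N (⌊R(⟨2,2,2⟩^{⊠N}) / r⌋ + 1)` — since
`⟨2,2,2⟩^{⊠N} ≤ ⟨R⟩ ≤ ⟨B r⟩ = ⟨B⟩ ⊠ ⟨r⟩ ≤ ⟨B⟩ ⊠ C₁^{⊠N}`. [cite: Zuiddam2018, §2.3, §2.8] -/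
theorem helped_of_diagonal {N r : ℕ} (hr : 0 < r)
    (hdiag : TensorRestrictsTo (kroneckerPow coupling₁ N) (unitTensor ℂ r)) :
    Helped N (tensorRank (kroneckerPow (matMulTensor ℂ 2 2 2) N) / r + 1) := by
  rw [helped_iff_le]
  set R := tensorRank (kroneckerPow (matMulTensor ℂ 2 2 2) N) with hR
  have hRB : R ≤ (R / r + 1) * r := by
    have := Nat.lt_mul_div_succ R hr
    rw [mul_comm] at this
    exact this.le
  calc TensorClass.mk (matMulTensor ℂ 2 2 2) ^ N
        = TensorClass.mk (kroneckerPow (matMulTensor ℂ 2 2 2) N) := TensorClass.mk_pow _ _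
    _ ≤ (R : TensorClass ℂ) := TensorClass.mk_le_natCast_tensorRank _
    _ ≤ (((R / r + 1) * r : ℕ) : TensorClass ℂ) := TensorClass.natCast_le_natCast_iff.2 hRB
    _ = ((R / r + 1 : ℕ) : TensorClass ℂ) * (r : TensorClass ℂ) := by push_cast; ring
    _ ≤ ((R / r + 1 : ℕ) : TensorClass ℂ) * TensorClass.mk coupling₁ ^ N :=
        TensorClass.mul_le_mul le_rfl (by
          rw [TensorClass.mk_pow, TensorClass.natCast_eq_mk, TensorClass.mk_le_mk_iff]
          exact hdiag)

/-- `R(⟨2,2,2⟩^{⊠N}) ≤ C · 2^{(ω+δ)N}` from a rank bound `R(⟨a,a,a⟩) ≤ C a^{ω+δ}` (via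
`R(⟨2,2,2⟩^{⊠N}) ≤ R(⟨2^N,2^N,2^N⟩)`). [cite: AlmanDuanVassilevskaWilliamsXuXuZhou2025, §3.4] -/
theorem tensorRank_matMul_pow_le (N : ℕ) {δ C : ℝ}
    (hC : ∀ a : ℕ, 1 ≤ a → (tensorRank (matMulTensor ℂ a a a) : ℝ) ≤ C * (a : ℝ) ^ (omega ℂ + δ)) :
    (tensorRank (kroneckerPow (matMulTensor ℂ 2 2 2) N) : ℝ) ≤ C * (2 : ℝ) ^ ((omega ℂ + δ) * N) := by
  have h1 := tensorRank_kroneckerPow_matMulTensor_le ℂ 2 2 2 N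
  have h2 := hC (2 ^ N) Nat.one_le_two_pow
  have e : (2 : ℝ) ^ ((omega ℂ + δ) * N) = ((2 ^ N : ℕ) : ℝ) ^ (omega ℂ + δ) := by
    rw [mul_comm, Real.rpow_mul (by norm_num : (0 : ℝ) ≤ 2), Real.rpow_natCast]
    push_cast
    rfl
  rw [e]
  calc (tensorRank (kroneckerPow (matMulTensor ℂ 2 2 2) N) : ℝ)
        ≤ tensorRank (matMulTensor ℂ (2 ^ N) (2 ^ N) (2 ^ N)) := by exact_mod_cast h1
    _ ≤ C * ((2 ^ N : ℕ) : ℝ) ^ (omega ℂ + δ) := h2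

/-- **THE LASER FLOOR: every rate `θ > ω(ℂ) − 2` is achieved** — `Q̃(C₁) = 4` (lens-4's `BlockDiagonal`,
`blockDiagonal_holds`: cofinally `⟨r⟩ ≤ C₁^{⊠N}`, `r ≥ 4^N 2^{-δN}`) against `R(⟨2,2,2⟩^{⊠N}) ≤ C 2^{(ω+δ)N}`
gives `B = ⌊R/r⌋ + 1 ≤ 2^{(ω−2+3δ)N}` helping copies. [cite: Strassen1988, Thm. 3.8] -/
theorem exponentAchieved_of_gt_omega_sub_two {θ : ℝ} (hθ : omega ℂ - 2 < θ) : ExponentAchieved θ := by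
  obtain ⟨δ, hδ, hθδ⟩ : ∃ δ : ℝ, 0 < δ ∧ omega ℂ - 2 + 3 * δ ≤ θ :=
    ⟨(θ - (omega ℂ - 2)) / 3, div_pos (by linarith) (by norm_num), le_of_eq (by ring)⟩
  obtain ⟨C, hC0, hC⟩ := exists_tensorRank_matMulTensor_le_rpow ℂ hδ
  have hω2 : 2 ≤ omega ℂ := omega_two_le ℂ
  have hq1 : 1 < (2 : ℝ) ^ δ := Real.one_lt_rpow (by norm_num) hδ
  obtain ⟨N₁, hN₁⟩ :=
    ((tendsto_pow_atTop_atTop_of_one_lt hq1).eventually_ge_atTop (C + 1)).exists_forall_of_atTop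
  intro N₀
  obtain ⟨N, hN, r, ⟨hdiag, -, -⟩, hr⟩ :=
    OutsiderSandwichBlockSubrank.blockDiagonal_holds δ hδ (max N₀ N₁)
  have hN₀ : N₀ ≤ N := le_of_max_le_left hN
  have hNN₁ : N₁ ≤ N := le_of_max_le_right hN
  have h4pos : (0 : ℝ) < (4 : ℝ) ^ N := by positivity
  have hr0 : 0 < r := by
    rcases Nat.eq_zero_or_pos r with h | h
    · subst h
      simp at hr
      linarith
    · exact h
  have hr0' : (0 : ℝ) < r := by exact_mod_cast hr0
  set R := tensorRank (kroneckerPow (matMulTensor ℂ 2 2 2) N) with hR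
  refine ⟨N, hN₀, R / r + 1, helped_of_diagonal hr0 hdiag, ?_⟩
  have hRle : (R : ℝ) ≤ C * (2 : ℝ) ^ ((omega ℂ + δ) * N) := tensorRank_matMul_pow_le N hC
  have h4 : (4 : ℝ) ^ N = (2 : ℝ) ^ ((2 : ℝ) * N) := by
    rw [Real.rpow_mul_natCast (by norm_num : (0 : ℝ) ≤ 2), Real.rpow_two]
    norm_num
  have hsplit : (2 : ℝ) ^ ((omega ℂ + δ) * N) =
      (2 : ℝ) ^ ((omega ℂ - 2 + δ) * N) * (2 : ℝ) ^ ((2 : ℝ) * N) := by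
    rw [← Real.rpow_add (by norm_num : (0 : ℝ) < 2)]
    congr 1
    ring
  have hkey : (R : ℝ) ≤ C * (2 : ℝ) ^ ((omega ℂ - 2 + 2 * δ) * N) * r := by
    calc (R : ℝ) ≤ C * (2 : ℝ) ^ ((omega ℂ + δ) * N) := hRle
      _ = C * (2 : ℝ) ^ ((omega ℂ - 2 + δ) * N) * (4 : ℝ) ^ N := by rw [hsplit, h4]; ring
      _ ≤ C * (2 : ℝ) ^ ((omega ℂ - 2 + δ) * N) * ((r : ℝ) * (2 : ℝ) ^ (δ * N)) :=
          mul_le_mul_of_nonneg_left hr (by positivity)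
      _ = C * (2 : ℝ) ^ ((omega ℂ - 2 + 2 * δ) * N) * r := by
          rw [show (omega ℂ - 2 + 2 * δ) * N = (omega ℂ - 2 + δ) * N + δ * N by ring,
            Real.rpow_add (by norm_num : (0 : ℝ) < 2)]
          ring
  have hdiv : ((R / r : ℕ) : ℝ) ≤ C * (2 : ℝ) ^ ((omega ℂ - 2 + 2 * δ) * N) := by
    calc ((R / r : ℕ) : ℝ) ≤ (R : ℝ) / r := Nat.cast_div_le
      _ ≤ C * (2 : ℝ) ^ ((omega ℂ - 2 + 2 * δ) * N) := by rw [div_le_iff₀ hr0']; exact hkey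
  have ha : 0 ≤ (omega ℂ - 2 + 2 * δ) * N := mul_nonneg (by linarith) (Nat.cast_nonneg _)
  have hone : (1 : ℝ) ≤ (2 : ℝ) ^ ((omega ℂ - 2 + 2 * δ) * N) := Real.one_le_rpow (by norm_num) ha
  have hC1 : C + 1 ≤ (2 : ℝ) ^ (δ * N) := by
    have := hN₁ N hNN₁
    rwa [← Real.rpow_mul_natCast (by norm_num : (0 : ℝ) ≤ 2)] at this
  have h2pos : (0 : ℝ) ≤ (2 : ℝ) ^ ((omega ℂ - 2 + 2 * δ) * N) := by positivity
  calc ((R / r + 1 : ℕ) : ℝ) = ((R / r : ℕ) : ℝ) + 1 := by push_cast; ring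
    _ ≤ C * (2 : ℝ) ^ ((omega ℂ - 2 + 2 * δ) * N) + 1 * (2 : ℝ) ^ ((omega ℂ - 2 + 2 * δ) * N) :=
        add_le_add hdiv (by simpa using hone)
    _ = (C + 1) * (2 : ℝ) ^ ((omega ℂ - 2 + 2 * δ) * N) := by ring
    _ ≤ (2 : ℝ) ^ (δ * N) * (2 : ℝ) ^ ((omega ℂ - 2 + 2 * δ) * N) :=
        mul_le_mul_of_nonneg_right hC1 h2pos
    _ = (2 : ℝ) ^ ((omega ℂ - 2 + 3 * δ) * N) := by
        rw [← Real.rpow_add (by norm_num : (0 : ℝ) < 2)]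
        congr 1
        ring
    _ ≤ (2 : ℝ) ^ (θ * N) :=
        Real.rpow_le_rpow_of_exponent_le (by norm_num)
          (mul_le_mul_of_nonneg_right hθδ (Nat.cast_nonneg _))

/-- **Numerically: every rate `θ > 0.37295` is achieved** (the tree's kernel bound `ω ≤ 2.37295`).
[cite: LeGall2014, Table 2] -/
theorem exponentAchieved_of_gt_leGall {θ : ℝ} (hθ : (0.37295 : ℝ) < θ) : ExponentAchieved θ := by
  apply exponentAchieved_of_gt_omega_sub_two
  have hω := LeGall2014_cw4_omega_le ℂ
  norm_num at hω hθ ⊢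
  linarith

/-! ## 4. The extremal form: the exchange exponent `θ⋆` -/

/-- **The exchange exponent `θ⋆(C₁ ∣ ⟨2,2,2⟩) := inf {θ | ExponentAchieved θ}`** — the least rate of
helping copies at which powers of the block absorb powers of `2 × 2` matrix multiplication.
[cite: Strassen1988, Thm. 3.8] -/
def exchangeExponent : ℝ :=
  sInf {θ : ℝ | ExponentAchieved θ}

/-- The set of achieved rates is non-empty (`1` is achieved). [folklore] -/
theorem achieved_nonempty : ({θ : ℝ | ExponentAchieved θ}).Nonempty :=
  ⟨1, exponentAchieved_one⟩

/-- The set of achieved rates is bounded below by `0`. [folklore] -/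
theorem achieved_bddBelow : BddBelow {θ : ℝ | ExponentAchieved θ} :=
  ⟨0, fun _ hθ => (ExponentAchieved.pos hθ).le⟩

/-- `0 ≤ θ⋆`. [cite: Blaser2013, Thm. 6.3] -/
theorem exchangeExponent_nonneg : 0 ≤ exchangeExponent :=
  le_csInf achieved_nonempty fun _ hθ => (ExponentAchieved.pos hθ).le

/-- `θ⋆ ≤ θ` for every achieved `θ`. [folklore] -/
theorem exchangeExponent_le {θ : ℝ} (h : ExponentAchieved θ) : exchangeExponent ≤ θ :=
  csInf_le achieved_bddBelow h

/-- Everything strictly above `θ⋆` is achieved (up-set). [folklore] -/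
theorem exponentAchieved_of_exchangeExponent_lt {θ : ℝ} (h : exchangeExponent < θ) :
    ExponentAchieved θ := by
  obtain ⟨θ', hθ', hlt⟩ := exists_lt_of_csInf_lt achieved_nonempty h
  exact ExponentAchieved.mono hθ' hlt.le

/-- Nothing strictly below `θ⋆` is achieved. [folklore] -/
theorem not_exponentAchieved_of_lt_exchangeExponent {θ : ℝ} (h : θ < exchangeExponent) :
    ¬ ExponentAchieved θ :=
  fun hθ => absurd (exchangeExponent_le hθ) (not_le.2 h)

/-- `θ⋆ ≤ 1`. [folklore] -/
theorem exchangeExponent_le_one : exchangeExponent ≤ 1 :=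
  exchangeExponent_le exponentAchieved_one

/-- **`θ⋆ ≤ ω(ℂ) − 2`** (the laser floor). [cite: Strassen1988, Thm. 3.8] -/
theorem exchangeExponent_le_omega_sub_two : exchangeExponent ≤ omega ℂ - 2 := by
  by_contra h
  push Not at h
  have h1 : omega ℂ - 2 < (exchangeExponent + (omega ℂ - 2)) / 2 := by linarith
  have h2 := exchangeExponent_le (exponentAchieved_of_gt_omega_sub_two h1)
  linarith

/-- **`θ⋆ ≤ 0.37295`** numerically. [cite: LeGall2014, Table 2] -/
theorem exchangeExponent_le_leGall : exchangeExponent ≤ 0.37295 := by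
  have h := exchangeExponent_le_omega_sub_two
  have hω := LeGall2014_cw4_omega_le ℂ
  norm_num at hω ⊢
  linarith

/-- `θ⋆ ∈ [0, 0.37295]`. [cite: LeGall2014, Table 2] -/
theorem exchangeExponent_mem_Icc : exchangeExponent ∈ Set.Icc (0 : ℝ) 0.37295 :=
  ⟨exchangeExponent_nonneg, exchangeExponent_le_leGall⟩

/-- **THE EXTREMAL FORM OF THE LEAF: `BlockOneIsMM ⟺ θ⋆ = 0`.** [cite: Strassen1988, Thm. 3.8] -/
theorem blockOneIsMM_iff_exchangeExponent_eq_zero :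
    Theses.OutsiderSandwich.BlockOneIsMM ↔ exchangeExponent = 0 := by
  rw [blockOneIsMM_iff_forall_exponentAchieved]
  constructor
  · intro H
    refine le_antisymm ?_ exchangeExponent_nonneg
    by_contra h
    push Not at h
    have h1 := exchangeExponent_le (H (exchangeExponent / 2) (by linarith))
    linarith
  · intro H θ hθ
    exact exponentAchieved_of_exchangeExponent_lt (by rw [H]; exact hθ)

/-- **`¬ BlockOneIsMM ⟺ θ⋆ > 0`**: a counterexample to the leaf is a positive number, not a configuration.
[cite: Strassen1988, Thm. 3.8] -/
theorem not_blockOneIsMM_iff_exchangeExponent_pos :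
    ¬ Theses.OutsiderSandwich.BlockOneIsMM ↔ 0 < exchangeExponent := by
  rw [blockOneIsMM_iff_exchangeExponent_eq_zero]
  exact ⟨fun h => lt_of_le_of_ne exchangeExponent_nonneg (Ne.symm h), fun h => h.ne'⟩

/-- **`ω = 2 ⟹ θ⋆ = 0`.** [cite: Strassen1988, Thm. 3.8] -/
theorem exchangeExponent_eq_zero_of_summit (hS : _root_.MatrixMultiplication) : exchangeExponent = 0 :=
  blockOneIsMM_iff_exchangeExponent_eq_zero.1
    (OutsiderSandwichBlockOneItems.blockOneIsMM_of_summit_items hS)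

/-- **The cut in extremal form: `ω = 2 ⟺ θ⋆ = 0 ∧ CouplingMergeOptimal`.** [cite: Strassen1988, Thm. 3.8] -/
theorem summit_iff_exchangeExponent :
    _root_.MatrixMultiplication ↔ exchangeExponent = 0 ∧ Theses.OutsiderSandwich.CouplingMergeOptimal :=
  OutsiderSandwichBlockOneItems.summit_iff_blockOneIsMM_items.trans
    (and_congr blockOneIsMM_iff_exchangeExponent_eq_zero Iff.rfl)

/-- **`ω > 2 ⟺ θ⋆ > 0 ∨ ¬ CouplingMergeOptimal`.** [cite: Strassen1988, Thm. 3.8] -/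
theorem not_summit_iff :
    ¬ _root_.MatrixMultiplication ↔ 0 < exchangeExponent ∨ ¬ Theses.OutsiderSandwich.CouplingMergeOptimal := by
  rw [summit_iff_exchangeExponent, not_and_or, ← not_blockOneIsMM_iff_exchangeExponent_pos,
    blockOneIsMM_iff_exchangeExponent_eq_zero]

/-! ## 5. The exchange numbers `r(N)` -/

/-- **The exchange number `r(N) := min {B | ⟨B⟩ ⊠ C₁^{⊠N} ⊵ ⟨2,2,2⟩^{⊠N}}`** (census I52/I59: `r(1) = 2`,
`r(2) = 2`, `r(3) ≤ 3`, `r(n) ≤ ⌈(4/3)^n⌉` for `n ≤ 6`). [cite: Strassen1988, Thm. 3.8] -/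
def exchangeNumber (N : ℕ) : ℕ :=
  sInf {B : ℕ | Helped N B}

/-- `r(N)` copies do help. [folklore] -/
theorem helped_exchangeNumber (N : ℕ) : Helped N (exchangeNumber N) :=
  Nat.sInf_mem (s := {B : ℕ | Helped N B}) ⟨2 ^ N, helped_pow_two_pow N⟩

/-- `r(N) ≤ B` for every helping `B`. [folklore] -/
theorem exchangeNumber_le {N B : ℕ} (h : Helped N B) : exchangeNumber N ≤ B :=
  Nat.sInf_le h

/-- `Helped N B ⟺ r(N) ≤ B`. [folklore] -/
theorem helped_iff_exchangeNumber_le {N B : ℕ} : Helped N B ↔ exchangeNumber N ≤ B :=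
  ⟨exchangeNumber_le, helped_mono (helped_exchangeNumber N)⟩

/-- **`r(N) ≤ 2^N`.** [folklore] -/
theorem exchangeNumber_le_two_pow (N : ℕ) : exchangeNumber N ≤ 2 ^ N :=
  exchangeNumber_le (helped_pow_two_pow N)

/-- **`2 ≤ r(N)`** for `N ≥ 1`. [cite: Blaser2013, Thm. 6.3] -/
theorem two_le_exchangeNumber {N : ℕ} (hN : 1 ≤ N) : 2 ≤ exchangeNumber N :=
  two_le_of_helped hN (helped_exchangeNumber N)

/-- `r(0) = 1`. [folklore] -/
theorem exchangeNumber_zero : exchangeNumber 0 = 1 := by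
  refine le_antisymm (exchangeNumber_le helped_zero_one) ?_
  rcases Nat.eq_zero_or_pos (exchangeNumber 0) with h | h
  · have h0 := helped_exchangeNumber 0
    rw [h] at h0
    exact absurd h0 (not_helped_zero 0)
  · exact h

/-- **`r(1) = 2`.** [cite: Blaser2013, Thm. 6.3] -/
theorem exchangeNumber_one : exchangeNumber 1 = 2 :=
  le_antisymm (exchangeNumber_le helped_one_two) (two_le_exchangeNumber le_rfl)

/-- **Submultiplicativity `r(M + N) ≤ r(M) r(N)`.** [folklore] -/
theorem exchangeNumber_add_le (M N : ℕ) :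
    exchangeNumber (M + N) ≤ exchangeNumber M * exchangeNumber N :=
  exchangeNumber_le (helped_mul (helped_exchangeNumber M) (helped_exchangeNumber N))

/-- `r(k N) ≤ r(N)^k`. [folklore] -/
theorem exchangeNumber_mul_le (k N : ℕ) : exchangeNumber (k * N) ≤ exchangeNumber N ^ k :=
  exchangeNumber_le (helped_pow (helped_exchangeNumber N) k)

/-- `ExponentAchieved θ ⟺ cofinally r(N) ≤ 2^{θN}`. [folklore] -/
theorem exponentAchieved_iff_exchangeNumber (θ : ℝ) :
    ExponentAchieved θ ↔ ∀ N₀ : ℕ, ∃ N : ℕ, N₀ ≤ N ∧ (exchangeNumber N : ℝ) ≤ (2 : ℝ) ^ (θ * N) := by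
  constructor
  · intro h N₀
    obtain ⟨N, hN, B, hB, hle⟩ := h N₀
    exact ⟨N, hN, (Nat.cast_le.2 (exchangeNumber_le hB)).trans hle⟩
  · intro h N₀
    obtain ⟨N, hN, hle⟩ := h N₀
    exact ⟨N, hN, exchangeNumber N, helped_exchangeNumber N, hle⟩

/-- **The leaf through the exchange numbers: `BlockOneIsMM ⟺ ∀ θ > 0, ∃ N ≥ 1, r(N) ≤ 2^{θN}`** — i.e.
`inf_N log₂ r(N) / N = 0`. [cite: Strassen1988, Thm. 3.8] -/
theorem blockOneIsMM_iff_exchangeNumber :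
    Theses.OutsiderSandwich.BlockOneIsMM ↔
      ∀ θ : ℝ, 0 < θ → ∃ N : ℕ, 1 ≤ N ∧ (exchangeNumber N : ℝ) ≤ (2 : ℝ) ^ (θ * N) := by
  rw [blockOneIsMM_iff_exists_certificate]
  refine forall₂_congr fun θ _ => ⟨?_, ?_⟩
  · rintro ⟨N, hN, B, hB, hle⟩
    exact ⟨N, hN, (Nat.cast_le.2 (exchangeNumber_le hB)).trans hle⟩
  · rintro ⟨N, hN, hle⟩
    exact ⟨N, hN, exchangeNumber N, helped_exchangeNumber N, hle⟩

/-! ## 6. Cofinal = eventual: an achieved rate holds at ALL large levels, up to any `ε` -/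

/-- **Padding**: if rate `θ` is achieved (cofinally), then every `θ' > θ` holds at ALL large `N'`
(`N' = kN + j`, `j < N`: `B^k 2^j` copies).  So `lim inf = lim sup` for `log₂ r(N)/N`: the stub's cofinal
form is as strong as the eventual form. [folklore] -/
theorem eventually_helped_of_exponentAchieved {θ θ' : ℝ} (h : ExponentAchieved θ) (hlt : θ < θ') :
    ∃ N₀ : ℕ, ∀ N' : ℕ, N₀ ≤ N' → ∃ B : ℕ, Helped N' B ∧ (B : ℝ) ≤ (2 : ℝ) ^ (θ' * N') := by
  have hθ : 0 < θ := h.pos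
  obtain ⟨N, hN, B, hB, hBle⟩ := h 1
  have hNpos : 0 < N := hN
  have hsub : 0 < θ' - θ := sub_pos.2 hlt
  obtain ⟨K, hK⟩ : ∃ K : ℕ, 1 / (θ' - θ) ≤ K := ⟨_, Nat.le_ceil _⟩
  refine ⟨K * N, fun N' hN' => ?_⟩
  obtain ⟨k, j, hdecomp, hKk, hjN⟩ : ∃ k j : ℕ, k * N + j = N' ∧ K ≤ k ∧ j < N :=
    ⟨N' / N, N' % N, by rw [mul_comm]; exact Nat.div_add_mod N' N,
      (Nat.le_div_iff_mul_le hNpos).2 hN', Nat.mod_lt _ hNpos⟩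
  subst hdecomp
  refine ⟨B ^ k * 2 ^ j, helped_mul (helped_pow hB k) (helped_pow_two_pow j), ?_⟩
  have hKθ : 1 ≤ (θ' - θ) * K := by
    rw [div_le_iff₀ hsub] at hK
    simpa [mul_comm] using hK
  have hKk' : (K : ℝ) ≤ k := by exact_mod_cast hKk
  have hjN' : (j : ℝ) + 1 ≤ N := by exact_mod_cast hjN
  have hN' : (0 : ℝ) < N := by exact_mod_cast hNpos
  have hθ'0 : 0 ≤ θ' := by linarith
  have hj0 : (0 : ℝ) ≤ j := Nat.cast_nonneg j
  have h1 : (N : ℝ) ≤ (θ' - θ) * N * k := by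
    calc (N : ℝ) = N * 1 := (mul_one _).symm
      _ ≤ N * ((θ' - θ) * K) := mul_le_mul_of_nonneg_left hKθ hN'.le
      _ ≤ N * ((θ' - θ) * k) :=
          mul_le_mul_of_nonneg_left (mul_le_mul_of_nonneg_left hKk' hsub.le) hN'.le
      _ = (θ' - θ) * N * k := by ring
  have h2 : 0 ≤ (j : ℝ) * θ' := mul_nonneg hj0 hθ'0
  have hexp : θ * N * k + j ≤ θ' * (((k * N + j : ℕ) : ℝ)) := by
    push_cast
    nlinarith
  calc ((B ^ k * 2 ^ j : ℕ) : ℝ) = (B : ℝ) ^ k * (2 : ℝ) ^ j := by push_cast; ring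
    _ ≤ ((2 : ℝ) ^ (θ * N)) ^ k * (2 : ℝ) ^ j :=
        mul_le_mul_of_nonneg_right (pow_le_pow_left₀ (Nat.cast_nonneg B) hBle k) (by positivity)
    _ = (2 : ℝ) ^ (θ * N * k + j) := by
        rw [Real.rpow_add (by norm_num : (0 : ℝ) < 2),
          Real.rpow_mul_natCast (by norm_num : (0 : ℝ) ≤ 2) (θ * N) k, Real.rpow_natCast 2 j]
    _ ≤ (2 : ℝ) ^ (θ' * (((k * N + j : ℕ) : ℝ))) :=
        Real.rpow_le_rpow_of_exponent_le (by norm_num) hexp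

/-- **`BlockOneIsMM` in EVENTUAL form: `∀ θ > 0, ∃ N₀, ∀ N ≥ N₀, ∃ B ≤ 2^{θN}, Helped N B`** — equivalent to
the stub's cofinal form. [cite: Strassen1988, Thm. 3.8] -/
theorem blockOneIsMM_iff_eventually :
    Theses.OutsiderSandwich.BlockOneIsMM ↔
      ∀ θ : ℝ, 0 < θ → ∃ N₀ : ℕ, ∀ N : ℕ, N₀ ≤ N → ∃ B : ℕ, Helped N B ∧ (B : ℝ) ≤ (2 : ℝ) ^ (θ * N) := by
  rw [blockOneIsMM_iff_forall_exponentAchieved]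
  constructor
  · intro H θ hθ
    exact eventually_helped_of_exponentAchieved (H (θ / 2) (by linarith)) (by linarith)
  · intro H θ hθ N₀
    obtain ⟨N₁, hN₁⟩ := H θ hθ
    obtain ⟨B, hB, hle⟩ := hN₁ (max N₀ N₁) (le_max_right _ _)
    exact ⟨max N₀ N₁, le_max_left _ _, B, hB, hle⟩

/-- Everything strictly above `θ⋆` holds at all large levels. [folklore] -/
theorem eventually_helped_of_exchangeExponent_lt {θ : ℝ} (h : exchangeExponent < θ) :
    ∃ N₀ : ℕ, ∀ N : ℕ, N₀ ≤ N → ∃ B : ℕ, Helped N B ∧ (B : ℝ) ≤ (2 : ℝ) ^ (θ * N) := by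
  have h1 : exchangeExponent < (exchangeExponent + θ) / 2 := by linarith
  exact eventually_helped_of_exponentAchieved (exponentAchieved_of_exchangeExponent_lt h1) (by linarith)

end Summit.MatrixMultiplication.MatrixMultiplication.Theorems.OutsiderSandwichExchangeExponent

end
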